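import Summits.QuantumFields.QCD.Theorems.HeatSlicedQuarksInterleavedFlowProperStubFormatHandover
import Summits.QuantumFields.QCD.Theorems.PauliWegnerSeaChiralGluonicCompletionGoldstoneOfHereditaryPin

/-!
# Crux `InterleavedFlowProper` (stmt-QuantumFields-18031), line `Sketch` gen 4 — stub `limitsAlong_of_locallyUniform` (K4)

The continuum package KΩ of the line is split (gen 4, lead c2) into its analytic core KΩ′ — limits of X₀'s periodic-quark
lattice Schwinger functions LOCALLY UNIFORMLY IN THE MASS TUPLE and FROM EVERY SUBSEQUENCE, `LocallyUniformQCDLimits` — and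
the purely logical step proved here: ONE strictly increasing extraction serving every mass tuple above the offset,
`limitsAlong_of_locallyUniform : LocallyUniformQCDLimits → QCDLimitsAlongOneSubsequence`.

Proof (Lindelöf + diagonal; the pattern of `Theorems.CertifiedSeaThresholdGraft.stub_diagonal`, crux 9152, adapted to a body
without gap clauses and with the scheme NOT re-indexed along the extraction):
* `exists_countable_centres_above` — countably many sup-boxes `{m | ∀ f, |m f − cᵢ f| < ε (cᵢ)}`, centres above `M₀`, cover the
  open orthant `{m | ∀ f, M₀ < m f}` (`Fin N_f → ℝ` is second countable, `TopologicalSpace.countable_cover_nhdsWithin`);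
* the diagonal argument is the tree's `Theorems.StronglyChiralSubsequence.exists_diagonal` (crux 17498; imported): countably
  many properties of integer sequences, each reachable from every strictly increasing sequence by a further extraction and each
  stable under "is eventually a reindexing of" (`Θ₂ j = Θ₁ (θ j)` for large `j`, `θ → ∞`), hold simultaneously along one
  strictly increasing sequence (nested extractions + the diagonal);
* the body "limits exist along `Θ` for every tuple of box `i`" is reachable (hypothesis) and hereditary: the same `z, shift, T`
  serve `Θ₂`, since `j ↦ S (Θ₂ j) = S (Θ₁ (θ j))` eventually and `Tendsto.comp` along `θ → ∞`.
-/

noncomputable section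

namespace Summit.QuantumFields.QCD.Cruxes.InterleavedFlowProper.OffsetLastFormatHandover

open Summit.QuantumFields.QCD.Theses.HeatSlicedQuarks
open Literature.MathematicalPhysics.QuantumFieldTheory Literature.MathematicalPhysics.QuantumLattice
  Literature.MathematicalPhysics.AQFT
open Filter Topology MeasureTheory

/-! ## §0 Skeleton-local definition of line `Sketch`, gen 4 (copied verbatim) -/

/-- **The honest output shape of the continuum package (KΩ′ target, gen 4).**  Same data as
`QCDLimitsAlongOneSubsequence` (offset `M₀`, ONE mass-independent regularisation, the physical-branch clause, species
renormalisations, OS data with non-trivial non-Gaussian glue and non-trivial flavour-changing pseudoscalars, convergence of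
X₀'s own periodic-quark lattice Schwinger functions), EXCEPT that the extraction is stated the way a stability-plus-compactness
construction delivers it: LOCALLY UNIFORMLY IN THE MASS TUPLE and FROM EVERY SUBSEQUENCE — every tuple `m₀` above `M₀` has a
sup-box of radius `ε > 0` such that from every strictly increasing `ψ` a further `φ` can be extracted along which (`ψ ∘ φ`)
the limits exist for all tuples of the box above `M₀` simultaneously.  The single `φ` in front of `∀ m` (audit item K4) is
then pure logic (`limitsAlong_of_locallyUniform`: Lindelöf in `Fin N_f → ℝ` + a diagonal argument). -/
def LocallyUniformQCDLimits : Prop :=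
  ∀ Nf : ℕ, Nf = 2 ∨ Nf = 3 → ∃ M₀ : ℝ, 0 ≤ M₀ ∧ ∃ reg : QCDRegularisation Nf, reg.HasMassScaling ∧
    (reg.scheme 0 0 0).HasAsymptoticScaling ∧
    ∀ m₀ : Fin Nf → ℝ, (∀ f, M₀ < m₀ f) → ∃ ε : ℝ, 0 < ε ∧
      ∀ ψ : ℕ → ℕ, StrictMono ψ → ∃ φ : ℕ → ℕ, StrictMono φ ∧
        ∀ m : Fin Nf → ℝ, (∀ f, M₀ < m f) → (∀ f, |m f - m₀ f| < ε) →
          (∀ fl, ∀ᶠ k in atTop, -1 < reg.mcrit k + reg.a k * m fl / reg.Zm k) ∧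
          ∃ (z shift : QCDField Nf → ℕ → ℝ) (T : OSData (QCDField Nf) 4),
            (∀ n : ℕ, n ≠ 0 → ∀ (σ : Fin n → QCDField Nf) (f : Fin n → SchwartzMap (EuclideanSpace ℝ (Fin 4)) ℝ)
              (F : SchwartzMap (Fin n → EuclideanSpace ℝ (Fin 4)) ℂ),
              IsTensorOf F (fun i => ofRealTest (f i)) → IsOffDiagonal F →
                Tendsto (fun j => qcdLatticeSchwinger (reg.scheme m z shift) (ψ (φ j)) n σ f) atTop
                  (𝓝 (T.schwinger n σ F))) ∧
            T.IsNontrivial QCDField.glue ∧ T.IsNonGaussian QCDField.glue ∧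
              ∀ f g : Fin Nf, f ≠ g → T.IsNontrivial (QCDField.pseudoRe f g)

/-! ## §1 The soft lemma not yet in the tree in this form (threshold version of Lindelöf) -/

/-- **Countably many centres suffice** (Lindelöf; adapted from `Theorems.CertifiedSeaThresholdGraft.stub_diagonal`'s private
lemma).  Given radii `ε m₀ > 0` for the tuples `m₀` above the threshold `M₁`, there is a sequence of centres `c i` above the
threshold such that every tuple `m` above the threshold lies in one of the boxes `{m | ∀ f, |m f - c i f| < ε (c i)}`: these
boxes are the open balls of the sup metric on `Fin N_f → ℝ`, a second-countable space, so countably many of them cover the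
orthant (`TopologicalSpace.countable_cover_nhdsWithin`); the countable set (plus the tuple `M₁ + 1`, to make it non-empty) is
then enumerated. [folklore] -/
theorem exists_countable_centres_above {Nf : ℕ} (M₁ : ℝ) (ε : (Fin Nf → ℝ) → ℝ)
    (hε : ∀ m₀ : Fin Nf → ℝ, (∀ f, M₁ < m₀ f) → 0 < ε m₀) :
    ∃ c : ℕ → Fin Nf → ℝ, (∀ i f, M₁ < c i f) ∧
      ∀ m : Fin Nf → ℝ, (∀ f, M₁ < m f) → ∃ i, ∀ f, |m f - c i f| < ε (c i) := by
  obtain ⟨t, htU, htc, hUt⟩ := TopologicalSpace.countable_cover_nhdsWithin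
    (s := {m : Fin Nf → ℝ | ∀ f, M₁ < m f}) (f := fun x => Metric.ball x (ε x))
    fun x hx => mem_nhdsWithin_of_mem_nhds (Metric.ball_mem_nhds x (hε x hx))
  obtain ⟨c, hc⟩ := (htc.insert (fun _ => M₁ + 1 : Fin Nf → ℝ)).exists_eq_range (Set.insert_nonempty _ _)
  refine ⟨c, fun i => ?_, fun m hm => ?_⟩
  · have hci : c i ∈ insert (fun _ => M₁ + 1 : Fin Nf → ℝ) t := by rw [hc]; exact Set.mem_range_self i
    rcases Set.mem_insert_iff.1 hci with h | h
    · rw [h]; exact fun _ => lt_add_one M₁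
    · exact htU h
  · have hmU : m ∈ {m : Fin Nf → ℝ | ∀ f, M₁ < m f} := hm
    obtain ⟨x, hx, hmx⟩ := Set.mem_iUnion₂.1 (hUt hmU)
    have hxc : x ∈ Set.range c := by rw [← hc]; exact Set.mem_insert_of_mem _ hx
    obtain ⟨i, rfl⟩ := hxc
    refine ⟨i, fun f => ?_⟩
    have h := (dist_pi_lt_iff (hε _ (htU hx))).1 (Metric.mem_ball.1 hmx) f
    rwa [Real.dist_eq] at h

/-! ## §2 The registered stub -/

/-- **Registered stub `limitsAlong_of_locallyUniform` (K4, gen 4): ONE strictly increasing extraction serves every mass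
tuple above the offset.**  Countably many sup-boxes cover the open orthant above `M₀` (`exists_countable_centres_above`);
run the tree's diagonal argument (`Theorems.StronglyChiralSubsequence.exists_diagonal`) on the properties "for every tuple of the `i`-th box above `M₀`
the physical-branch clause holds and X₀'s periodic-quark lattice Schwinger functions converge along `Θ` to OS data with the
three non-triviality clauses", which are reachable by extraction (the hypothesis `LocallyUniformQCDLimits` at the `i`-th
centre) and hereditary under eventual reindexing `Θ₂ j = Θ₁ (θ j)`, `θ → ∞` (same `z, shift, T`; `Tendsto.comp` along `θ`
and `Filter.Tendsto.congr'`) — the scheme `reg.scheme m z shift` is not re-indexed, only the running index is. [folklore] -/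
theorem limitsAlong_of_locallyUniform : LocallyUniformQCDLimits → QCDLimitsAlongOneSubsequence := by
  intro h Nf hNf
  obtain ⟨M₀, hM₀, reg, hms, has, hloc⟩ := h Nf hNf
  refine ⟨M₀, hM₀, reg, hms, has, ?_⟩
  choose! ε hε hH using hloc
  obtain ⟨c, hc, hcov⟩ := exists_countable_centres_above M₀ ε hε
  -- the body along `Θ` on the `i`-th box
  obtain ⟨Φ, hΦ, hP⟩ := Theorems.StronglyChiralSubsequence.exists_diagonal
    (P := fun i Θ => ∀ m : Fin Nf → ℝ, (∀ f, M₀ < m f) → (∀ f, |m f - c i f| < ε (c i)) →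
      (∀ fl, ∀ᶠ k in atTop, -1 < reg.mcrit k + reg.a k * m fl / reg.Zm k) ∧
      ∃ (z shift : QCDField Nf → ℕ → ℝ) (T : OSData (QCDField Nf) 4),
        (∀ n : ℕ, n ≠ 0 → ∀ (σ : Fin n → QCDField Nf) (f : Fin n → SchwartzMap (EuclideanSpace ℝ (Fin 4)) ℝ)
          (F : SchwartzMap (Fin n → EuclideanSpace ℝ (Fin 4)) ℂ),
          IsTensorOf F (fun i => ofRealTest (f i)) → IsOffDiagonal F →
            Tendsto (fun j => qcdLatticeSchwinger (reg.scheme m z shift) (Θ j) n σ f) atTop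
              (𝓝 (T.schwinger n σ F))) ∧
        T.IsNontrivial QCDField.glue ∧ T.IsNonGaussian QCDField.glue ∧
          ∀ f g : Fin Nf, f ≠ g → T.IsNontrivial (QCDField.pseudoRe f g))
    (fun i ψ hψ => by
      obtain ⟨φ, hφ, hb⟩ := hH (c i) (hc i) ψ hψ
      exact ⟨φ, hφ, fun m hm hmi => hb m hm hmi⟩)
    (fun i Θ₁ Θ₂ θ _ _ hθ heq hb m hm hmi => by
      obtain ⟨hbr, z, shift, T, hconv, hN, hG, hPs⟩ := hb m hm hmi
      refine ⟨hbr, z, shift, T, fun n hn σ f F hF hoff => ?_, hN, hG, hPs⟩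
      refine ((hconv n hn σ f F hF hoff).comp hθ).congr' ?_
      filter_upwards [heq] with j hj
      show qcdLatticeSchwinger (reg.scheme m z shift) (Θ₁ (θ j)) n σ f =
        qcdLatticeSchwinger (reg.scheme m z shift) (Θ₂ j) n σ f
      rw [hj])
  exact ⟨Φ, hΦ, fun m hm => (hcov m hm).elim fun i hi => hP i m hm hi⟩

end Summit.QuantumFields.QCD.Cruxes.InterleavedFlowProper.OffsetLastFormatHandover

end
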